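/-
Copyright: the b2b-balaban cell (near-miss cell 7), T⁴-continuum fan-out; row NE7b swarm table S10 (tagged-socket form),
supplied by the swarm seat `t4-ne7b-formalise-leaf-07`.  Released under the licence of the surrounding project.
-/
import Summits.QuantumFields.BalabanUV.T4Continuum.Support.HistoryConstantsExist
import Summits.QuantumFields.BalabanUV.T4Continuum.Support.HistorySocketTagged

/-!
# Row NE7b, leaf S10 (tagged form): the CELL-TAGGED history socket transfers along a refinement of the constants

Summits-side support leaf of the T⁴-continuum cell (rung (B)+1 on a FINITE torus only; NOT infinite volume, NOT the
mass gap, NOT the Clay statement; NOT a proof of the spine estimate NE7b).  Claim table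
`t4/b2b-balaban-t4-ne7b-p1/LEAVES-NE7b.md` row S10, for the socket the swarm's H∕P rows target since the owner's
ruling F-ne7bp1g22-2: `HistorySocketTagged.LiveHistoriesT` (live STRUCTURES `(root cell, genealogy)`).  [folklore]
bookkeeping over the lineage's OWN typed carrier; nothing quoted from print, nothing printed asserted, no
`def … : Prop` fact minted (c1), no numerals (c2∕c6).

WHAT.  §1 the product steps of `HistoryConstantsExist` over an INDEXED family of genealogies (`∏ q ∈ S, shapeZ … (f q)`,
any index type — pairs `(z, G)` for the tagged socket): `prod_shapeZ_map_le_of_refines`, `prod_shapeZ_map_mul_exp_le_lowerA`.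
§2 **`liveHistoriesT_of_refines`**: `Refines C Cp → LiveHistoriesT Cp … live → LiveHistoriesT C … live` (same live
data; `Kz ≥ 1`, `σ ≥ 0`, `Λ′ ≥ 0`, profile base `log g_{K,s}⁻² ≥ 0` along the runs — all asked by the exit anyway), and
the END in use form **`relWeightBound_of_liveHistoriesT_refines`**: the tagged socket filled at the transcription's
record `Cp`, any refining `C` with `ThresholdOK C L r β₀` and the exit's remaining binders stated at `C` ⇒
`RelWeightBound` (`HistorySocketTagged.relWeightBound_of_liveHistoriesT` by name).  §3 sanity: the transfer applied to
the untagged witness instance read as a tagged one.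

HONEST DEPENDENCY (cell): continuum YM on T⁴ ⇐ BetaPertH ∧ nine spine estimates (0/9 proved); BetaPertH ⇐ (D1) ∧ (D4)
∧ CAP+tail.  This file changes none of it.
-/

open Finset
open Literature.MathematicalPhysics.QuantumFieldTheory.Balaban1983to89
open T4PersistenceDictionary T4PersistentHistoryCount T4BankedInduction T4PrintedShapeBanking T4PartnerMultiplicity
open T4WeightBudget T4GlobalDenominator T4LiveClassFibration T4LiveStructureGas T4LiveGasToTerms T4RecordPriceSeam
open Summit.QuantumFields.BalabanUV.T4Continuum.PlacementBatch
open Summit.QuantumFields.BalabanUV.T4Continuum.PlacementSkeleton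
open Summit.QuantumFields.BalabanUV.T4Continuum.PartnerMultiplicityF
open Summit.QuantumFields.BalabanUV.T4Continuum.PartnerMultiplicityZ
open Summit.QuantumFields.BalabanUV.T4Continuum.Crowding
open Summit.QuantumFields.BalabanUV.T4Continuum.CountThresholdUniform
open Summit.QuantumFields.BalabanUV.T4Continuum.HistorySocket
open Summit.QuantumFields.BalabanUV.T4Continuum.HistorySocketTagged
open Summit.QuantumFields.BalabanUV.T4Continuum.HistoryConstantsExist

namespace Summit.QuantumFields.BalabanUV.T4Continuum.HistoryConstantsExistTagged

noncomputable section

/-! ## §1 Product steps over an indexed family of genealogies -/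

section Products

variable {α : Type*} {C Cp : T4PrintedShapeBanking.Consts} {Kz p σ Λ' : ℝ}

/-- **PRODUCT STEP, INDEXED**: along a refinement `C` of `Cp`, a bound by `∏_{q ∈ S} shapeZ Cp … (f q)` over any
indexed family of consistent genealogies is a bound by the same product at `C`. [folklore] -/
theorem prod_shapeZ_map_le_of_refines (h : Refines C Cp) (hKz : 1 ≤ Kz) (hσ : 0 ≤ σ) (hΛ : 0 ≤ Λ')
    (R : ℕ → ℕ → ℕ) (g : ℕ → ℕ → ℝ) (K : ℕ) (hx : ∀ s, s ≤ K → 0 ≤ Real.log ((g K s) ^ 2)⁻¹)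
    {S : Finset α} (f : α → Gen PEv) (hS : ∀ q ∈ S, Consistent Cp K (R K) (f q)) {x : ℝ}
    (hle : x ≤ ∏ q ∈ S, shapeZ Cp Kz p σ Λ' R g K (f q)) : x ≤ ∏ q ∈ S, shapeZ C Kz p σ Λ' R g K (f q) :=
  hle.trans (prod_le_prod (fun q _ => shapeZ_nonneg hKz hσ hΛ R g K (f q))
    fun q hq => shapeZ_le h (zero_le_one.trans hKz) hσ hΛ R g K hx (step_le_of_consistent (hS q hq)))

/-- **PRODUCT STEP WITH ABSORPTION, INDEXED**: a bound by `∏_{q ∈ S} shapeZ Cp … (f q)·e^{θ·birthLin (f q)}` is a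
bound by `∏_{q ∈ S} shapeZ (lowerA Cp θ) … (f q)` (`θ ≥ 0`, profile `≥ 1` at the birth steps). [folklore] -/
theorem prod_shapeZ_map_mul_exp_le_lowerA (hKz : 1 ≤ Kz) (hσ : 0 ≤ σ) (hΛ : 0 ≤ Λ') {θ : ℝ} (hθ : 0 ≤ θ)
    (R : ℕ → ℕ → ℕ) (g : ℕ → ℕ → ℝ) (K : ℕ) {S : Finset α} (f : α → Gen PEv)
    (hP : ∀ q ∈ S, ∀ e ∈ (f q).events, e.kind = 0 → 1 ≤ p0Profile Cp.A₀ Cp.p₀ (g K e.step)) {x : ℝ}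
    (hle : x ≤ ∏ q ∈ S, shapeZ Cp Kz p σ Λ' R g K (f q) * Real.exp (θ * birthLin (f q))) :
    x ≤ ∏ q ∈ S, shapeZ (lowerA Cp θ) Kz p σ Λ' R g K (f q) :=
  hle.trans (prod_le_prod (fun q _ => mul_nonneg (shapeZ_nonneg hKz hσ hΛ R g K (f q)) (Real.exp_pos _).le)
    fun q hq => shapeZ_mul_exp_le_lowerA (zero_le_one.trans hKz) hσ hΛ hθ R g K (hP q hq))

end Products

/-! ## §2 The tagged socket transfers along a refinement -/

section Socket

variable {γ κ : Type*} {C Cp : T4PrintedShapeBanking.Consts} {Kz p σ Λ' l₀ : ℝ} {K₀ : ℕ} {R : ℕ → ℕ → ℕ}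
  {g : ℕ → ℕ → ℝ} {Cell : ℕ → ℕ → Finset γ} {E B : ℕ → ℕ → Finset PEv} {jstar : ℕ → ℕ}
  {Bad' : ℕ → ℝ → Finset κ} {F Rf F' Rf' : ℕ → κ → ℝ} {live : ℕ → κ → Finset (γ × Gen PEv)}

/-- **THE CELL-TAGGED HISTORY SOCKET TRANSFERS ALONG A REFINEMENT.**  If the live structures fill
`LiveHistoriesT` at the transcription's record `Cp`, they fill it at every `C` refining `Cp` (same live data),
provided `Kz ≥ 1`, `σ ≥ 0`, `Λ′ ≥ 0` and the profile base `log g_{K,s}⁻²` is nonnegative along the runs.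
`consistent`∕`wf`∕`pending` transfer because the windows `dictW R n₁` coincide; `price`∕`price'` by the indexed
product step; the other six fields do not mention the constants. [folklore] -/
theorem liveHistoriesT_of_refines (h : Refines C Cp) (hKz : 1 ≤ Kz) (hσ : 0 ≤ σ) (hΛ : 0 ≤ Λ')
    (hx : ∀ K, K₀ ≤ K → ∀ s, s ≤ K → 0 ≤ Real.log ((g K s) ^ 2)⁻¹)
    (H : LiveHistoriesT Cp Kz p σ Λ' l₀ K₀ R g Cell E B jstar Bad' F Rf F' Rf' live) :
    LiveHistoriesT C Kz p σ Λ' l₀ K₀ R g Cell E B jstar Bad' F Rf F' Rf' live where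
  consistent K q hK hq := (consistent_iff_of_n₁_eq h.n₁_eq K (R K) q.2).2 (H.consistent K q hK hq)
  wf K q hK hq := by rw [dictW_eq h]; exact H.wf K q hK hq
  pending K q hK hq := by rw [dictW_eq h]; exact H.pending K q hK hq
  cell_mem := H.cell_mem
  root_mem := H.root_mem
  events_sub := H.events_sub
  old := H.old
  slot_inj := H.slot_inj
  live_inj := H.live_inj
  price K t ht hK c hc :=
    prod_shapeZ_map_le_of_refines h hKz hσ hΛ R g K (hx K hK) Prod.snd
      (fun q hq => H.consistent K q hK ⟨t, ht, c, hc, hq⟩) (H.price K t ht hK c hc)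
  price' K t ht hK c hc :=
    prod_shapeZ_map_le_of_refines h hKz hσ hΛ R g K (hx K hK) Prod.snd
      (fun q hq => H.consistent K q hK ⟨t, ht, c, hc, hq⟩) (H.price' K t ht hK c hc)

/-- **THE TAGGED SOCKET AT RE-CHOSEN MARGINS**: filled at `Cp` (nonnegative amplitude), it is filled at
`withMargins Cp κ₁ E₀ Eb μ` for every choice of the count margins. [folklore] -/
theorem liveHistoriesT_withMargins (hA : 0 ≤ Cp.A₀) (κ₁ E₀ Eb μ : ℝ) (hKz : 1 ≤ Kz) (hσ : 0 ≤ σ) (hΛ : 0 ≤ Λ')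
    (hx : ∀ K, K₀ ≤ K → ∀ s, s ≤ K → 0 ≤ Real.log ((g K s) ^ 2)⁻¹)
    (H : LiveHistoriesT Cp Kz p σ Λ' l₀ K₀ R g Cell E B jstar Bad' F Rf F' Rf' live) :
    LiveHistoriesT (withMargins Cp κ₁ E₀ Eb μ) Kz p σ Λ' l₀ K₀ R g Cell E B jstar Bad' F Rf F' Rf' live :=
  liveHistoriesT_of_refines (refines_withMargins hA) hKz hσ hΛ hx H

end Socket

/-! ## §2b The END in use form: socket at the transcription record, exit at any refinement -/

section Exit

variable {γ κ ι : Type*} [DecidableEq γ] [DecidableEq κ] {l₀ : ℝ} {K₀ : ℕ} {π : ℕ → ι → κ}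
  {T : ℕ → Finset ι} {A A' : ℕ → ℝ → ι → ℝ} {Bad' : ℕ → ℝ → Finset κ} {dead dead' : ℕ → ℝ → ι → ℝ}
  {F Rf F' Rf' : ℕ → κ → ℝ} {nlow nup mlow mup : ℕ → ℝ → ℝ} {Cn : ℝ}

/-- **NE7b's COUNT EXIT WITH THE SOCKET FILLED AT THE TRANSCRIPTION RECORD.**
`HistorySocketTagged.relWeightBound_of_liveHistoriesT` at symbolic constants `C` refining `Cp`, the tagged socket
being supplied at `Cp`; every other binder verbatim at `C`.  (`hx1 : 1 ≤ log g⁻²` gives the nonnegative profile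
base the transfer needs.) [folklore] -/
theorem relWeightBound_of_liveHistoriesT_refines {C Cp : T4PrintedShapeBanking.Consts} {L rr : ℕ} {β₀ : ℝ}
    (href : Refines C Cp) (h : ThresholdOK C L rr β₀)
    {Kz p σ ε θ : ℝ} (hKz : 1 ≤ Kz) (hp : 0 ≤ p) (h0 : 0 < σ) (h1 : σ < 1) (hε : 0 < ε) (hθ : 0 < θ)
    (Cell : ℕ → ℕ → Finset γ) {V Λ : ℝ} (hV : 0 ≤ V) (hΛ : 0 < Λ)
    (hcell : ∀ K a, ((Cell K a).card : ℝ) ≤ V * Λ ^ a) (E Bk : ℕ → ℕ → Finset PEv)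
    (hE : ∀ K j, ∀ e ∈ E K j, PEv.step e ∈ Ioc j K) (jstar : ℕ → ℕ) (hj : ∀ K, jstar K ≤ K) {c : ℝ} (hc : 0 < c)
    (hfrac : ∀ K : ℕ, c * K ≤ ((K - jstar K : ℕ) : ℝ))
    (hA : Regeneration l₀ π T A Bad' dead F Rf nlow nup Cn K₀)
    (hA' : Regeneration l₀ π T A' Bad' dead' F' Rf' mlow mup Cn K₀) (hCn : 0 ≤ Cn)
    (R : ℕ → ℕ → ℕ) (g : ℕ → ℕ → ℝ) (β' : ℕ → ℝ)
    (h27 : ∀ K, K₀ ≤ K → B14.FlowIneq27 (g K) (β' K) β₀ C.p₀ K)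
    (h29 : ∀ K, K₀ ≤ K → B14FlowStep.FlowIneq29 (R K) (g K) L (β' K) β₀ K)
    (hR : ∀ K, K₀ ≤ K → ∀ s, s ≤ K → B14.IsRj L rr (g K s) (R K s))
    (hx1 : ∀ K, K₀ ≤ K → ∀ s, s ≤ K → 1 ≤ Real.log ((g K s) ^ 2)⁻¹)
    (hir : ∀ K, K₀ ≤ K → irThresholdZ C Kz p σ ε θ L rr β₀ ≤ Real.log ((g K K) ^ 2)⁻¹)
    {ρbar ηbar : ℝ} (hρbar : ∀ K j, ∑ b ∈ Bk K j, rho C (g K) b ≤ ρbar)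
    (hηbar : ∀ K j, ∀ t ∈ Ioc j K, ∑ e ∈ E K j with PEv.step e = t, eta C e ≤ ηbar)
    (hrate : Λ * Real.exp (ηbar - C.κ₁) < 1) {Λ' : ℝ} (hΛ0 : 0 ≤ Λ') (hΛ1 : Λ' * Real.exp ε * Real.exp (-C.κ₁) ≤ 1)
    {live : ℕ → κ → Finset (γ × Gen PEv)}
    (H : LiveHistoriesT Cp Kz p σ Λ' l₀ K₀ R g Cell E Bk jstar Bad' F Rf F' Rf' live) :
    ∃ K₁, K₀ ≤ K₁ ∧ RelWeightBound l₀ T A A' (fun K t => if K₁ ≤ K then badOfClass π T Bad' K t else ∅)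
      (Set.indicator {K | K₁ ≤ K} (fun K => Cn * recordsBudget ρbar C.κ₁ V Λ ηbar jstar K)) :=
  relWeightBound_of_liveHistoriesT h hKz hp h0 h1 hε hθ Cell hV hΛ hcell E Bk hE jstar hj hc hfrac hA hA' hCn R g β'
    h27 h29 hR hx1 hir hρbar hηbar hrate hΛ0 hΛ1
    (liveHistoriesT_of_refines href hKz h0.le hΛ0 (fun K hK s hs => zero_le_one.trans (hx1 K hK s hs)) H)

end Exit

/-! ## §3 Sanity -/

namespace Sanity

/-- the transfer is not vacuous: the untagged empty-class instance read as a tagged one, at the cross-read's toy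
record `C₀` re-margined with bank rate `5`, from the instance at `C₀`. [folklore] -/
example (Kz p σ Λ' l₀ : ℝ) (hKz : 1 ≤ Kz) (hσ : 0 ≤ σ) (hΛ : 0 ≤ Λ') (K₀ : ℕ) (R : ℕ → ℕ → ℕ)
    (Cell : ℕ → ℕ → Finset ℕ) (E B : ℕ → ℕ → Finset PEv) (jstar : ℕ → ℕ) (F Rf F' Rf' : ℕ → Unit → ℝ)
    (H : LiveHistoriesT XreadC4.C₀ Kz p σ Λ' l₀ K₀ R (fun _ _ => Real.exp (-1)) Cell E B jstar
      (fun _ _ => (∅ : Finset Unit)) F Rf F' Rf' (fun _ _ => (∅ : Finset (ℕ × Gen PEv)))) :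
    LiveHistoriesT (withMargins XreadC4.C₀ 5 0 0 0) Kz p σ Λ' l₀ K₀ R (fun _ _ => Real.exp (-1)) Cell E B jstar
      (fun _ _ => (∅ : Finset Unit)) F Rf F' Rf' (fun _ _ => (∅ : Finset (ℕ × Gen PEv))) :=
  liveHistoriesT_withMargins (by simp [XreadC4.C₀]) 5 0 0 0 hKz hσ hΛ
    (fun K _ s _ => by
      rw [Real.log_inv, neg_nonneg, ← Real.exp_nat_mul, Real.log_exp]; norm_num) H

end Sanity

end

end Summit.QuantumFields.BalabanUV.T4Continuum.HistoryConstantsExistTagged
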